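import Summits.CriticalPhenomena.PercolationContinuityZ3.Theorems.PercNearOneGluingNoHeavyRsw3ClusterForestWeight
import Summits.CriticalPhenomena.PercolationContinuityZ3.Theorems.PercNearOneGluingNoHeavyRsw3VolumeLargestClusterMoments
import HarnessLib

/-!
# RSW3 lane (P2, gen 22): BCKS CLUSTER MOMENTS, II — ALL MOMENTS OF THE SIZE-BIASED CLUSTER SUM
# `Σ_{C} |C ∩ Λ_N|² = Σ_{x ∈ Λ_N} |C(x) ∩ Λ_N|` ARE `≍ (|Λ_N| π_{p_c}(N))^{2t}` UNDER (A2)□ (every `d`; `ℤ²` unconditional)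

builds on p205010 (kernel theorem, internal audit signed; external expert review pending) — NOT used in this file.

Cell `prim-rsw3`, prover seat `prim-rsw3-p2` (gen 22), memo `run/shared/lean/prim/rsw3/P2-RSWLITE.md` §29.
Support file (`--supports stmt-CriticalPhenomena-4575`); no definitions, no named facts, no sorries.

`V_x = #{w ∈ Λ(N) : x ↔ w}`, `T_N = #{(x,w) ∈ Λ(N)² : x ↔ w} = Σ_x V_x = Σ_C |C ∩ Λ(N)|²` (sum over the open clusters `C`),
`M_N = max_x V_x = |C_max(Λ_N)|`, `s(N) = (2N+1)^d π(N)`, `π = π_p = oneArmProb d p`.  Borgs–Chayes–Kesten–Spencer (CMP 2001 Thm. 1.1,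
RSA 1999; Thm. 2 of Chayes' ICM report) prove under their Scaling Axioms (verified in `d = 2`) that inside the scaling window every
`W^{(i)}_{Λ_N}` is of order `s(N)` and the number of clusters of a given scale is tight.  Here, from (A2)□ ALONE at `p_c(ℤ^d)`:
* §1 (pointwise) `card_filter_pairs_eq_sum` (`T_N = Σ_x V_x`), `card_filter_pairs_eq_card_add` (`T_N = |Λ_N| + T'_N`, off-diagonal
  pairs), `sq_sup_le_pairCount` (`M_N² ≤ T_N`);
* §2 (every `p > 0`, (R1), (R_lin), (R2), `π(1) > 0`) **`exists_integral_pairCount_pow_le`: `E_p T_N^{t+1} ≤ C_t s_p(N)^{2t+2}`** —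
  `T'^{t+1}` is a sum over `(t+1)`-tuples of off-diagonal pairs, each term at most the FOREST WEIGHT of part I (no BK), the `2t+2`
  points re-indexed as one tuple, the unrooted lattice sum of part I; diagonal `|Λ_N|^{t+1} ≤ C s(N)^{2t+2}` by (R1);
* §3 (`p_c(ℤ^d)`, `d ≥ 2`, (A2)□ at one aspect) **`exists_integral_pairCount_pow_two_sided_of_setToSetQuasiMultAspectAt`:
  `c s(N)^{2t+2} ≤ E_{p_c} T_N^{t+1} ≤ C s(N)^{2t+2}`** (`N ≥ N₀`; lower: `M_N^{2t+2} ≤ T_N^{t+1}` + gen 21) — all moments of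
  `Σ_C |C ∩ Λ_N|²` live on the single scale `s(N)² = |C_max|²`; §4 `…_Z2` — `ℤ²` at `1/2`, unconditionally.
Part III: the NUMBER of clusters with at least `ε s(N)` sites has all moments `≤ C_t ε^{−2t}`.

References: C. Borgs, J. T. Chayes, H. Kesten, J. Spencer, Comm. Math. Phys. 224 (2001) 153–204, Thm. 1.1; J. T. Chayes, Doc. Math.
Extra Vol. ICM 1998 III, 113–122, Thms. 1–2 [BorgsChayesKestenSpencer2001]; Random Structures Algorithms 15 (1999) 368–413
[BorgsChayesKestenSpencer1999]; H. Kesten, Probab. Theory Relat. Fields 73 (1986), Thm. (8) [Kesten1986]; D. Basu, A. Sapozhnikov,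
ECP 22 (2017) §1 (A2) [BasuSapozhnikov2017ECP]. [folklore]
-/

noncomputable section

namespace Summit.CriticalPhenomena.PercolationContinuityZ3.Theorems

namespace Rsw3

open MeasureTheory Literature.Probability.LatticeModels Literature.Probability.Percolation
open SurfaceTension Crossing SimpleGraph Finset
open Literature.Barriers.CriticalPhenomena (sub_mem_box_two_mul)

variable {d : ℕ}

/-! ## §1 The pair count `T_N`: cluster sum, diagonal split, and the largest cluster -/

open Classical in
/-- **`T_N = Σ_{x ∈ Λ(N)} V_x`**: the number of connected ordered pairs of `Λ(N)` is the sum of the cluster counts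
(`= Σ_C |C ∩ Λ(N)|²` over the clusters `C`). [folklore] -/
theorem card_filter_pairs_eq_sum (N : ℕ) (ω : BondConfig (Site d)) :
    (((box d N ×ˢ box d N).filter fun xw => ω ∈ (openConn xw.1 xw.2 : Set (BondConfig (Site d)))).card : ℝ) =
      ∑ x ∈ box d N, ((((box d N).filter fun w => ω ∈ (openConn x w : Set (BondConfig (Site d)))).card : ℕ) : ℝ) := by
  classical
  have h : ((box d N ×ˢ box d N).filter fun xw => ω ∈ (openConn xw.1 xw.2 : Set (BondConfig (Site d)))).card =
      ∑ x ∈ box d N, ((box d N).filter fun w => ω ∈ (openConn x w : Set (BondConfig (Site d)))).card := by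
    rw [Finset.card_filter, Finset.sum_product]
    refine Finset.sum_congr rfl fun x _ => ?_
    rw [Finset.card_filter]
  rw [h]; push_cast; rfl

open Classical in
/-- **Diagonal split `T_N = |Λ(N)| + T'_N`**, `T'_N = #{(x,w) ∈ Λ(N)^2 : x ≠ w, x ↔ w}` (every diagonal pair is connected). [folklore] -/
theorem card_filter_pairs_eq_card_add (N : ℕ) (ω : BondConfig (Site d)) :
    ((box d N ×ˢ box d N).filter fun xw => ω ∈ (openConn xw.1 xw.2 : Set (BondConfig (Site d)))).card =
      (box d N).card + ((box d N).offDiag.filter fun xw => ω ∈ (openConn xw.1 xw.2 : Set (BondConfig (Site d)))).card := by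
  classical
  rw [← Finset.diag_union_offDiag, Finset.filter_union,
    Finset.card_union_of_disjoint (Finset.disjoint_filter_filter (Finset.disjoint_diag_offDiag (box d N)))]
  congr 1
  rw [← Finset.diag_card (s := box d N)]
  congr 1
  refine Finset.filter_true_of_mem fun xw hxw => ?_
  rw [Finset.mem_diag] at hxw
  rw [← hxw.2]
  exact SimpleGraph.Reachable.refl _

open Classical in
/-- **`M_N² ≤ T_N`** (every site of the largest cluster has `V = M_N`; gen 21 `pow_sup_le_sum_pow` at `t = 1`). [folklore] -/
theorem sq_sup_le_pairCount (N : ℕ) (ω : BondConfig (Site d)) :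
    (((box d N).sup fun y => ((box d N).filter fun w => ω ∈ (openConn y w : Set (BondConfig (Site d)))).card : ℕ) : ℝ) ^ 2 ≤
      (((box d N ×ˢ box d N).filter fun xw => ω ∈ (openConn xw.1 xw.2 : Set (BondConfig (Site d)))).card : ℝ) := by
  classical
  rw [card_filter_pairs_eq_sum]
  have h := pow_sup_le_sum_pow (d := d) N 1 ω
  simpa using h

/-! ## §2 Every `p`: all moments of `T_N` -/

open Classical in
/-- The count of connected pairs in a finite set `D` of ordered pairs (cast to `ℝ`) is measurable (`T_N`: `D = Λ(N)²`; `T'_N`: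
`D = offDiag Λ(N)`). [folklore] -/
theorem measurable_card_filter_pairSet (D : Finset (Site d × Site d)) :
    Measurable fun ω : BondConfig (Site d) =>
      (((D.filter fun xw => ω ∈ (openConn xw.1 xw.2 : Set (BondConfig (Site d)))).card : ℕ) : ℝ) := by
  classical
  have h : (fun ω : BondConfig (Site d) =>
      (((D.filter fun xw => ω ∈ (openConn xw.1 xw.2 : Set (BondConfig (Site d)))).card : ℕ) : ℝ)) =
      fun ω => ∑ xw ∈ D, (openConn xw.1 xw.2 : Set (BondConfig (Site d))).indicator 1 ω := by
    funext ω; exact card_filter_mem_eq_sum_indicator _ _ ω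
  rw [h]
  exact Finset.measurable_sum _ fun xw _ => measurable_const.indicator (measurableSet_openConn_holds xw.1 xw.2)

open Classical in
/-- `0 ≤ #{connected pairs in D} ≤ |D|`, so every power of the pair count is integrable for a finite measure. [folklore] -/
theorem integrable_card_filter_pairSet_pow (μ : Measure (BondConfig (Site d))) [IsFiniteMeasure μ]
    (D : Finset (Site d × Site d)) (t : ℕ) :
    Integrable (fun ω : BondConfig (Site d) =>
      (((D.filter fun xw => ω ∈ (openConn xw.1 xw.2 : Set (BondConfig (Site d)))).card : ℕ) : ℝ) ^ t) μ := by
  classical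
  refine (integrable_const (((D.card : ℕ) : ℝ) ^ t)).mono'
    ((measurable_card_filter_pairSet D).pow_const t).aestronglyMeasurable (Filter.Eventually.of_forall fun ω => ?_)
  have h0 : (0 : ℝ) ≤ (((D.filter fun xw => ω ∈ (openConn xw.1 xw.2 : Set (BondConfig (Site d)))).card : ℕ) : ℝ) :=
    Nat.cast_nonneg _
  rw [Real.norm_eq_abs, abs_of_nonneg (pow_nonneg h0 t)]
  exact pow_le_pow_left₀ h0 (by exact_mod_cast Finset.card_filter_le _ _) t

/-- **Re-indexing point tuples**: for an equivalence `e : ι ≃ κ` of index types,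
`Σ_{z : κ → Λ} W(range z) = Σ_{z : ι → Λ} W(range z)` (`z ↦ z ∘ e`; the range is unchanged). [folklore] -/
theorem sum_piFinset_weight_reindex (p : unitInterval) {ι κ : Type*} [Fintype ι] [Fintype κ] [DecidableEq ι]
    [DecidableEq κ] (e : ι ≃ κ)
    (Λ : Finset (Site d)) :
    ∑ z ∈ Fintype.piFinset (fun _ : κ => Λ),
        ∏ x ∈ Finset.univ.image z,
          oneArmProb d p ((((Finset.erase (Finset.univ.image z) x).inf
            (fun w => ((Site.supNorm (x - w) : ℕ) : ℕ∞))).toNat - 1) / 2) =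
      ∑ z ∈ Fintype.piFinset (fun _ : ι => Λ),
        ∏ x ∈ Finset.univ.image z,
          oneArmProb d p ((((Finset.erase (Finset.univ.image z) x).inf
            (fun w => ((Site.supNorm (x - w) : ℕ) : ℕ∞))).toNat - 1) / 2) := by
  classical
  set ψ : (κ → Site d) ≃ (ι → Site d) :=
    { toFun := fun z => z ∘ e
      invFun := fun z => z ∘ e.symm
      left_inv := fun z => by funext j; simp
      right_inv := fun z => by funext i; simp } with hψ
  have himage : ∀ z : κ → Site d, Finset.univ.image (z ∘ e) = Finset.univ.image z := by
    intro z
    ext w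
    simp only [Finset.mem_image, Finset.mem_univ, true_and, Function.comp_apply]
    constructor
    · rintro ⟨i, hi⟩; exact ⟨e i, hi⟩
    · rintro ⟨j, hj⟩; exact ⟨e.symm j, by simpa using hj⟩
  refine Finset.sum_equiv ψ (fun z => ?_) (fun z _ => ?_)
  · rw [Fintype.mem_piFinset, Fintype.mem_piFinset]
    simp only [hψ, Equiv.coe_fn_mk, Function.comp_apply]
    constructor
    · intro h i; exact h (e i)
    · intro h j; simpa using h (e.symm j)
  · simp only [hψ, Equiv.coe_fn_mk]
    rw [himage z]

/-- `Λ.offDiag ⊆ Λ ×ˢ Λ`. [folklore] -/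
theorem offDiag_subset_product (Λ : Finset (Site d)) : Λ.offDiag ⊆ Λ ×ˢ Λ := by
  classical
  intro xw hxw
  rw [Finset.mem_offDiag] at hxw
  exact Finset.mem_product.2 ⟨hxw.1, hxw.2.1⟩

open Classical in
/-- **THE OFF-DIAGONAL MOMENTS** (every `p > 0`, `d ≥ 1`, (R1), (R_lin), (R2), `π(1) > 0`): for every `t` there is `C > 0` with, for all
`N ≥ 1`, `E_p T'_N^{t+1} ≤ C · |Λ(N)| · ((2N)^dπ(2N))^{2t+1} · π(2N)`:
`E T'^{t+1} = Σ_{q : Fin (t+1) → offDiag} P_p(⋂_i {q_i.1 ↔ q_i.2})` (the moment of a count is the tuple sum), each term is at most the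
forest weight `W(range q.1 ∪ range q.2)` (part I, no BK inequality), the pair tuples embed into point tuples `Fin (2t+2) → Λ(N)`, and
the unrooted lattice sum of part I bounds the total. [cite: BorgsChayesKestenSpencer2001, Thm. 1.1] [cite: Kesten1986, Thm. (8)] -/
theorem exists_integral_offDiag_pow_le (hd : 1 ≤ d) (p : unitInterval) (hp : 0 < (p : ℝ)) {A A' B : ℝ} (hA : 0 ≤ A)
    (hA' : 0 ≤ A')
    (hR1 : ∀ j n : ℕ, 1 ≤ j → j ≤ n →
      oneArmProb d p j ^ 2 * ((j : ℝ) / (16 * n)) ^ (d - 1) ≤ A * oneArmProb d p n ^ 2)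
    (hRlin : ∀ j n : ℕ, 1 ≤ j → j ≤ n →
      oneArmProb d p j * ((j : ℝ) / (4 * n)) ^ (d - 1) ≤ A' * oneArmProb d p n)
    (hR2 : ∀ j n : ℕ, 1 ≤ j → j ≤ n → n ≤ 8 * j → oneArmProb d p j ≤ B * oneArmProb d p n)
    (hπ1 : 0 < oneArmProb d p 1) (t : ℕ) :
    ∃ C : ℝ, 0 < C ∧ ∀ N : ℕ, 1 ≤ N →
      ∫ ω, ((((box d N).offDiag.filter fun xw =>
          ω ∈ (openConn xw.1 xw.2 : Set (BondConfig (Site d)))).card : ℕ) : ℝ) ^ (t + 1) ∂(bondPercolation (zdGraph d) p) ≤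
        C * (((box d N).card : ℝ) * ((((2 * N : ℕ) : ℝ) ^ d * oneArmProb d p (2 * N)) ^ (2 * t + 1) * oneArmProb d p (2 * N))) := by
  classical
  obtain ⟨C, hC, hle⟩ := exists_sum_piFinset_weight_unrooted_le hd p hp hA hA' hR1 hRlin hR2 hπ1 (2 * t)
  set μ := bondPercolation (zdGraph d) p with hμ
  refine ⟨C, hC, fun N hN => ?_⟩
  -- the moment is the tuple sum
  rw [integral_card_filter_pow_eq_sum μ (box d N).offDiag
    (fun xw : Site d × Site d => (openConn xw.1 xw.2 : Set (BondConfig (Site d))))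
    (fun xw _ => measurableSet_openConn_holds xw.1 xw.2) (t + 1)]
  -- each term is at most the forest weight of its `2t+2` points
  have hterm : ∀ q ∈ Fintype.piFinset (fun _ : Fin (t + 1) => (box d N).offDiag),
      μ.real (⋂ i, (openConn (q i).1 (q i).2 : Set (BondConfig (Site d)))) ≤
        ∏ x ∈ Finset.univ.image (Prod.fst ∘ q) ∪ Finset.univ.image (Prod.snd ∘ q),
          oneArmProb d p ((((Finset.erase (Finset.univ.image (Prod.fst ∘ q) ∪ Finset.univ.image (Prod.snd ∘ q)) x).inf
            (fun w => ((Site.supNorm (x - w) : ℕ) : ℕ∞))).toNat - 1) / 2) := by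
    intro q hq
    rw [Fintype.mem_piFinset] at hq
    have hne : ∀ i, (Prod.fst ∘ q) i ≠ (Prod.snd ∘ q) i := fun i => (Finset.mem_offDiag.1 (hq i)).2.2
    exact real_iInter_openConn_pair_le_weight p (Prod.fst ∘ q) (Prod.snd ∘ q) hne
  refine (Finset.sum_le_sum hterm).trans ?_
  refine (sum_piFinset_pair_le (t := t + 1) (offDiag_subset_product (box d N)) (fun S => ∏ x ∈ S,
    oneArmProb d p ((((Finset.erase S x).inf (fun w => ((Site.supNorm (x - w) : ℕ) : ℕ∞))).toNat - 1) / 2))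
    (fun S => Finset.prod_nonneg fun x _ => measureReal_nonneg)).trans ?_
  -- re-index `Fin ((t+1)+(t+1)) ≃ Fin (2t+2)` and apply the unrooted lattice sum
  have e : Fin (2 * t + 2) ≃ Fin (t + 1 + (t + 1)) := finCongr (by omega)
  rw [sum_piFinset_weight_reindex p e (box d N)]
  exact hle N hN

open Classical in
/-- **ALL MOMENTS OF THE SIZE-BIASED CLUSTER SUM** (every `p > 0`, `d ≥ 1`, (R1), (R_lin), (R2), `π(1) > 0`): for every `t` there is
`C > 0` with, for all `N ≥ 1`,
`E_p T_N^{t+1} ≤ C · ((2N+1)^d π_p(N))^{2t+2}`,   `T_N = #{(x,w) ∈ Λ(N)² : x ↔ w} = Σ_C |C ∩ Λ(N)|²`.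
(`T ≤ |Λ| + T'`, `(a+b)^{t+1} ≤ 2^{t+1}(a^{t+1} + b^{t+1})`; the diagonal: `|Λ(N)| ≤ (A·16^{d−1}/π(1)²)·s(N)²` by (R1) at `j = 1`; the
off-diagonal: `exists_integral_offDiag_pow_le` with `(2N)^dπ(2N) ≤ s(N)`, `π(2N) ≤ π(N)`.)
[cite: BorgsChayesKestenSpencer2001, Thm. 1.1] [cite: Kesten1986, Thm. (8)] -/
theorem exists_integral_pairCount_pow_le (hd : 1 ≤ d) (p : unitInterval) (hp : 0 < (p : ℝ)) {A A' B : ℝ} (hA : 0 ≤ A)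
    (hA' : 0 ≤ A')
    (hR1 : ∀ j n : ℕ, 1 ≤ j → j ≤ n →
      oneArmProb d p j ^ 2 * ((j : ℝ) / (16 * n)) ^ (d - 1) ≤ A * oneArmProb d p n ^ 2)
    (hRlin : ∀ j n : ℕ, 1 ≤ j → j ≤ n →
      oneArmProb d p j * ((j : ℝ) / (4 * n)) ^ (d - 1) ≤ A' * oneArmProb d p n)
    (hR2 : ∀ j n : ℕ, 1 ≤ j → j ≤ n → n ≤ 8 * j → oneArmProb d p j ≤ B * oneArmProb d p n)
    (hπ1 : 0 < oneArmProb d p 1) (t : ℕ) :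
    ∃ C : ℝ, 0 < C ∧ ∀ N : ℕ, 1 ≤ N →
      ∫ ω, ((((box d N ×ˢ box d N).filter fun xw =>
          ω ∈ (openConn xw.1 xw.2 : Set (BondConfig (Site d)))).card : ℕ) : ℝ) ^ (t + 1) ∂(bondPercolation (zdGraph d) p) ≤
        C * ((2 * (N : ℝ) + 1) ^ d * oneArmProb d p N) ^ (2 * t + 2) := by
  classical
  obtain ⟨C₁, hC₁, hle₁⟩ := exists_integral_offDiag_pow_le hd p hp hA hA' hR1 hRlin hR2 hπ1 t
  set μ := bondPercolation (zdGraph d) p with hμ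
  -- the diagonal constant `K`: `|Λ(N)| ≤ K s(N)²`
  set K : ℝ := A * (16 : ℝ) ^ (d - 1) / oneArmProb d p 1 ^ 2 with hK
  have hK0 : 0 ≤ K :=
    div_nonneg (mul_nonneg hA (pow_nonneg (by norm_num) _)) (pow_nonneg hπ1.le 2)
  refine ⟨(2 : ℝ) ^ (t + 1) * (K ^ (t + 1) + C₁),
    mul_pos (pow_pos two_pos _) (add_pos_of_nonneg_of_pos (pow_nonneg hK0 _) hC₁), fun N hN => ?_⟩
  have hN0 : (0 : ℝ) < N := by exact_mod_cast hN
  have hπN : 0 ≤ oneArmProb d p N := measureReal_nonneg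
  have hπ2N : 0 ≤ oneArmProb d p (2 * N) := measureReal_nonneg
  set sN : ℝ := (2 * (N : ℝ) + 1) ^ d * oneArmProb d p N with hsN
  have hs0 : 0 ≤ sN := mul_nonneg (by positivity) hπN
  have hcard : ((box d N).card : ℝ) = (2 * (N : ℝ) + 1) ^ d := by rw [card_box]; push_cast; ring
  -- (a) the diagonal: `|Λ(N)| ≤ K s(N)²`
  have hdiag : ((box d N).card : ℝ) ≤ K * sN ^ 2 := by
    have h1 := hR1 1 N le_rfl hN
    have h16 : (0 : ℝ) < 16 * N := by positivity
    have hπ1sq : 0 < oneArmProb d p 1 ^ 2 := pow_pos hπ1 2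
    have hx : ((1 : ℕ) : ℝ) / (16 * N) = 1 / (16 * N) := by norm_num
    rw [hx] at h1
    -- `π(1)² ≤ A π(N)² (16N)^{d-1}`
    have hπ1le : oneArmProb d p 1 ^ 2 ≤ A * oneArmProb d p N ^ 2 * ((16 : ℝ) * N) ^ (d - 1) := by
      have h2 := mul_le_mul_of_nonneg_right h1 (pow_pos h16 (d - 1)).le
      have h3 : oneArmProb d p 1 ^ 2 * (1 / ((16 : ℝ) * N)) ^ (d - 1) * ((16 : ℝ) * N) ^ (d - 1) =
          oneArmProb d p 1 ^ 2 := by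
        rw [mul_assoc, ← mul_pow, one_div_mul_cancel h16.ne', one_pow, mul_one]
      rw [h3] at h2
      exact h2
    -- `(16N)^{d-1} ≤ 16^{d-1} (2N+1)^d`
    have hpow : ((16 : ℝ) * N) ^ (d - 1) ≤ (16 : ℝ) ^ (d - 1) * (2 * (N : ℝ) + 1) ^ d := by
      rw [mul_pow]
      refine mul_le_mul_of_nonneg_left ?_ (by positivity)
      calc (N : ℝ) ^ (d - 1) ≤ (2 * (N : ℝ) + 1) ^ (d - 1) := pow_le_pow_left₀ hN0.le (by linarith) _
        _ ≤ (2 * (N : ℝ) + 1) ^ d := pow_le_pow_right₀ (by linarith) (Nat.sub_le d 1)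
    have key : (2 * (N : ℝ) + 1) ^ d * oneArmProb d p 1 ^ 2 ≤ A * (16 : ℝ) ^ (d - 1) * sN ^ 2 := by
      calc (2 * (N : ℝ) + 1) ^ d * oneArmProb d p 1 ^ 2
          ≤ (2 * (N : ℝ) + 1) ^ d * (A * oneArmProb d p N ^ 2 * ((16 : ℝ) * N) ^ (d - 1)) :=
            mul_le_mul_of_nonneg_left hπ1le (by positivity)
        _ ≤ (2 * (N : ℝ) + 1) ^ d * (A * oneArmProb d p N ^ 2 * ((16 : ℝ) ^ (d - 1) * (2 * (N : ℝ) + 1) ^ d)) := by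
            refine mul_le_mul_of_nonneg_left ?_ (by positivity)
            exact mul_le_mul_of_nonneg_left hpow (mul_nonneg hA (pow_nonneg hπN 2))
        _ = A * (16 : ℝ) ^ (d - 1) * sN ^ 2 := by rw [hsN]; ring
    rw [hcard, hK]
    rw [← le_div_iff₀ hπ1sq] at key
    calc (2 * (N : ℝ) + 1) ^ d ≤ A * (16 : ℝ) ^ (d - 1) * sN ^ 2 / oneArmProb d p 1 ^ 2 := key
      _ = A * (16 : ℝ) ^ (d - 1) / oneArmProb d p 1 ^ 2 * sN ^ 2 := by ring
  -- (b) the off-diagonal: `|Λ| ((2N)^dπ(2N))^{2t+1} π(2N) ≤ s(N)^{2t+2}`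
  have hanti : oneArmProb d p (2 * N) ≤ oneArmProb d p N := DCT16.real_siteToBoundary_antitone _ (by omega)
  have hcast : ((2 * N : ℕ) : ℝ) ^ d ≤ (2 * (N : ℝ) + 1) ^ d := by
    push_cast; exact pow_le_pow_left₀ (by positivity) (by linarith) d
  have hs2N : ((2 * N : ℕ) : ℝ) ^ d * oneArmProb d p (2 * N) ≤ sN :=
    mul_le_mul hcast hanti hπ2N (by positivity)
  have hoff : ((box d N).card : ℝ) * ((((2 * N : ℕ) : ℝ) ^ d * oneArmProb d p (2 * N)) ^ (2 * t + 1) *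
      oneArmProb d p (2 * N)) ≤ sN ^ (2 * t + 2) := by
    have h2 : (((2 * N : ℕ) : ℝ) ^ d * oneArmProb d p (2 * N)) ^ (2 * t + 1) ≤ sN ^ (2 * t + 1) :=
      pow_le_pow_left₀ (mul_nonneg (by positivity) hπ2N) hs2N _
    calc ((box d N).card : ℝ) * ((((2 * N : ℕ) : ℝ) ^ d * oneArmProb d p (2 * N)) ^ (2 * t + 1) * oneArmProb d p (2 * N))
        ≤ (2 * (N : ℝ) + 1) ^ d * (sN ^ (2 * t + 1) * oneArmProb d p N) := by
          rw [hcard]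
          refine mul_le_mul_of_nonneg_left ?_ (by positivity)
          exact mul_le_mul h2 hanti hπ2N (pow_nonneg hs0 _)
      _ = sN ^ (2 * t + 2) := by rw [hsN]; ring
  -- (c) pointwise: `T^{t+1} ≤ 2^{t+1} (|Λ|^{t+1} + T'^{t+1})`
  have hpt : ∀ ω : BondConfig (Site d),
      ((((box d N ×ˢ box d N).filter fun xw => ω ∈ (openConn xw.1 xw.2 : Set (BondConfig (Site d)))).card : ℕ) : ℝ) ^ (t + 1) ≤
        (2 : ℝ) ^ (t + 1) * (((box d N).card : ℝ) ^ (t + 1) +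
          ((((box d N).offDiag.filter fun xw => ω ∈ (openConn xw.1 xw.2 : Set (BondConfig (Site d)))).card : ℕ) : ℝ) ^ (t + 1)) := by
    intro ω
    rw [card_filter_pairs_eq_card_add N ω]
    push_cast
    set a : ℝ := ((box d N).card : ℝ)
    set b : ℝ := ((((box d N).offDiag.filter fun xw => ω ∈ (openConn xw.1 xw.2 : Set (BondConfig (Site d)))).card : ℕ) : ℝ)
    have ha : 0 ≤ a := Nat.cast_nonneg _
    have hb : 0 ≤ b := Nat.cast_nonneg _
    rcases le_total a b with h | h
    · calc (a + b) ^ (t + 1) ≤ (2 * b) ^ (t + 1) := pow_le_pow_left₀ (add_nonneg ha hb) (by linarith) _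
        _ = 2 ^ (t + 1) * b ^ (t + 1) := mul_pow _ _ _
        _ ≤ 2 ^ (t + 1) * (a ^ (t + 1) + b ^ (t + 1)) := by gcongr; linarith [pow_nonneg ha (t + 1)]
    · calc (a + b) ^ (t + 1) ≤ (2 * a) ^ (t + 1) := pow_le_pow_left₀ (add_nonneg ha hb) (by linarith) _
        _ = 2 ^ (t + 1) * a ^ (t + 1) := mul_pow _ _ _
        _ ≤ 2 ^ (t + 1) * (a ^ (t + 1) + b ^ (t + 1)) := by gcongr; linarith [pow_nonneg hb (t + 1)]
  -- (d) integrate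
  have hint' := integrable_card_filter_pairSet_pow μ (box d N).offDiag (t + 1)
  have hrhs : Integrable (fun ω : BondConfig (Site d) => (2 : ℝ) ^ (t + 1) * (((box d N).card : ℝ) ^ (t + 1) +
      ((((box d N).offDiag.filter fun xw => ω ∈ (openConn xw.1 xw.2 : Set (BondConfig (Site d)))).card : ℕ) : ℝ) ^ (t + 1))) μ :=
    ((integrable_const _).add hint').const_mul _
  calc ∫ ω, ((((box d N ×ˢ box d N).filter fun xw =>
          ω ∈ (openConn xw.1 xw.2 : Set (BondConfig (Site d)))).card : ℕ) : ℝ) ^ (t + 1) ∂μ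
      ≤ ∫ ω, (2 : ℝ) ^ (t + 1) * (((box d N).card : ℝ) ^ (t + 1) +
          ((((box d N).offDiag.filter fun xw => ω ∈ (openConn xw.1 xw.2 : Set (BondConfig (Site d)))).card : ℕ) : ℝ) ^ (t + 1)) ∂μ :=
        integral_mono_of_nonneg (Filter.Eventually.of_forall fun ω => pow_nonneg (Nat.cast_nonneg _) _) hrhs
          (Filter.Eventually.of_forall hpt)
    _ = (2 : ℝ) ^ (t + 1) * (((box d N).card : ℝ) ^ (t + 1) +
          ∫ ω, ((((box d N).offDiag.filter fun xw =>
            ω ∈ (openConn xw.1 xw.2 : Set (BondConfig (Site d)))).card : ℕ) : ℝ) ^ (t + 1) ∂μ) := by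
        rw [integral_const_mul, integral_add (integrable_const _) hint', integral_const]
        simp [hμ]
    _ ≤ (2 : ℝ) ^ (t + 1) * ((K * sN ^ 2) ^ (t + 1) + C₁ * sN ^ (2 * t + 2)) := by
        refine mul_le_mul_of_nonneg_left (add_le_add ?_ ?_) (by positivity)
        · exact pow_le_pow_left₀ (Nat.cast_nonneg _) hdiag _
        · exact (hle₁ N hN).trans (mul_le_mul_of_nonneg_left hoff hC₁.le)
    _ = (2 : ℝ) ^ (t + 1) * (K ^ (t + 1) + C₁) * sN ^ (2 * t + 2) := by ring

/-! ## §3 At `p_c(ℤ^d)` under (A2)□: all moments of `T_N`, two-sided -/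

open Classical in
/-- **ALL MOMENTS OF `Σ_C |C ∩ Λ_N|²` ARE `≍ s(N)^{2t}` UNDER (A2)□** (`p_c(ℤ^d)`, `d ≥ 2`, (A2)□ at `(s,L)`, `2 ≤ s ≤ L`, `ϰ > 0`):
for every `t` there are `0 < c, C` and `N₀` with, for all `N ≥ N₀`,
`c · ((2N+1)^dπ_{p_c}(N))^{2t+2} ≤ E_{p_c} T_N^{t+1} ≤ C · ((2N+1)^dπ_{p_c}(N))^{2t+2}`,
`T_N = #{(x,w) ∈ Λ(N)² : x ↔ w} = Σ_{x ∈ Λ(N)} |C(x) ∩ Λ(N)| = Σ_C |C ∩ Λ(N)|²` — the size-biased cluster sum of the box has all its moments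
on the single scale `s(N)² = (|Λ_N|π_{p_c}(N))²`, the square of the largest cluster (Borgs–Chayes–Kesten–Spencer's finite-size scaling,
CMP 2001 Thm. 1.1, there for `d = 2` / under the Scaling Axioms; here from (A2)□ in every dimension).  Upper: §2 with the (A2)□ ratio
inequalities; lower: `M_N^{2t+2} ≤ T_N^{t+1}` and gen 21's `E_{p_c} M_N^{2t+2} ≥ c s(N)^{2t+2}`.
[cite: BorgsChayesKestenSpencer2001, Thm. 1.1] [cite: Kesten1986, Thm. (8)] [cite: BasuSapozhnikov2017ECP, §1 assumption (A2)] -/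
theorem exists_integral_pairCount_pow_two_sided_of_setToSetQuasiMultAspectAt (hd : 2 ≤ d) {s L : ℕ} (hs : 2 ≤ s) (hsL : s ≤ L)
    {ϰ : ℝ} (hϰ : 0 < ϰ) (h : SetToSetQuasiMultAspectAt d (criticalProbI d) s L ϰ) (t : ℕ) :
    ∃ c C : ℝ, 0 < c ∧ 0 < C ∧ ∃ N₀ : ℕ, ∀ N : ℕ, N₀ ≤ N →
      c * ((2 * (N : ℝ) + 1) ^ d * oneArmProb d (criticalProbI d) N) ^ (2 * t + 2) ≤
        ∫ ω, ((((box d N ×ˢ box d N).filter fun xw =>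
          ω ∈ (openConn xw.1 xw.2 : Set (BondConfig (Site d)))).card : ℕ) : ℝ) ^ (t + 1)
            ∂(bondPercolation (zdGraph d) (criticalProbI d)) ∧
      ∫ ω, ((((box d N ×ˢ box d N).filter fun xw =>
          ω ∈ (openConn xw.1 xw.2 : Set (BondConfig (Site d)))).card : ℕ) : ℝ) ^ (t + 1)
            ∂(bondPercolation (zdGraph d) (criticalProbI d)) ≤
        C * ((2 * (N : ℝ) + 1) ^ d * oneArmProb d (criticalProbI d) N) ^ (2 * t + 2) := by
  classical
  have hd1 : 1 ≤ d := by omega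
  obtain ⟨A, A', B, hA, hA', hR1, hRlin, hR2, hpc, hπ1⟩ := exists_ratios_of_setToSetQuasiMultAspectAt hd hs hsL hϰ h
  obtain ⟨C, hC, hup⟩ := exists_integral_pairCount_pow_le hd1 (criticalProbI d) hpc hA hA' hR1 hRlin hR2 hπ1 t
  obtain ⟨c, C', hc, -, N₀, hlow⟩ := exists_integral_sup_pow_two_sided_of_setToSetQuasiMultAspectAt hd hs hsL hϰ h (2 * t + 1)
  set μ := bondPercolation (zdGraph d) (criticalProbI d) with hμ
  refine ⟨c, C, hc, hC, max N₀ 1, fun N hN => ⟨?_, hup N (le_of_max_le_right hN)⟩⟩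
  have hN₀ : N₀ ≤ N := le_of_max_le_left hN
  have h221 : 2 * t + 1 + 1 = 2 * t + 2 := by ring
  have hl := (hlow N hN₀).1
  rw [h221] at hl
  refine hl.trans ?_
  -- `E M^{2t+2} ≤ E T^{t+1}` from `M² ≤ T`
  refine integral_mono_of_nonneg (Filter.Eventually.of_forall fun ω => pow_nonneg (Nat.cast_nonneg _) _)
    (integrable_card_filter_pairSet_pow μ _ (t + 1)) (Filter.Eventually.of_forall fun ω => ?_)
  have hsq := sq_sup_le_pairCount (d := d) N ω
  have h0 : (0 : ℝ) ≤ (((box d N).sup fun y => ((box d N).filter fun w =>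
      ω ∈ (openConn y w : Set (BondConfig (Site d)))).card : ℕ) : ℝ) := Nat.cast_nonneg _
  calc (((box d N).sup fun y => ((box d N).filter fun w =>
        ω ∈ (openConn y w : Set (BondConfig (Site d)))).card : ℕ) : ℝ) ^ (2 * t + 2)
      = ((((box d N).sup fun y => ((box d N).filter fun w =>
        ω ∈ (openConn y w : Set (BondConfig (Site d)))).card : ℕ) : ℝ) ^ 2) ^ (t + 1) := by rw [← pow_mul]; ring_nf
    _ ≤ _ := pow_le_pow_left₀ (pow_nonneg h0 2) hsq _

/-! ## §4 `ℤ²`, unconditionally -/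

open Classical in
/-- **`ℤ²` at `p_c = 1/2`, UNCONDITIONALLY**: all moments of `Σ_C |C ∩ Λ_N|²` are `≍ ((2N+1)² π_{1/2}(N))^{2t+2}` (BCKS 2001 in `d = 2`,
here via the planar (A2)□ from RSW). [cite: BorgsChayesKestenSpencer2001, Thm. 1.1] [cite: Kesten1986, Thm. (8)] -/
theorem exists_integral_pairCount_pow_two_sided_Z2 (t : ℕ) :
    ∃ c C : ℝ, 0 < c ∧ 0 < C ∧ ∃ N₀ : ℕ, ∀ N : ℕ, N₀ ≤ N →
      c * ((2 * (N : ℝ) + 1) ^ 2 * oneArmProb 2 (criticalProbI 2) N) ^ (2 * t + 2) ≤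
        ∫ ω, ((((box 2 N ×ˢ box 2 N).filter fun xw =>
          ω ∈ (openConn xw.1 xw.2 : Set (BondConfig (Site 2)))).card : ℕ) : ℝ) ^ (t + 1)
            ∂(bondPercolation (zdGraph 2) (criticalProbI 2)) ∧
      ∫ ω, ((((box 2 N ×ˢ box 2 N).filter fun xw =>
          ω ∈ (openConn xw.1 xw.2 : Set (BondConfig (Site 2)))).card : ℕ) : ℝ) ^ (t + 1)
            ∂(bondPercolation (zdGraph 2) (criticalProbI 2)) ≤
        C * ((2 * (N : ℝ) + 1) ^ 2 * oneArmProb 2 (criticalProbI 2) N) ^ (2 * t + 2) := by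
  classical
  obtain ⟨ϰ, hϰ, hA2⟩ := exists_setToSetQuasiMultAspectAt_two_of_criticalProbI_le
  exact exists_integral_pairCount_pow_two_sided_of_setToSetQuasiMultAspectAt (d := 2) le_rfl (by norm_num) (by norm_num) hϰ
    (hA2 _ le_rfl) t

end Rsw3

end Summit.CriticalPhenomena.PercolationContinuityZ3.Theorems
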